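import Summits.QuantumAdvantage.QuantumAdvantage.Theorems.SoloInformedValueLiftFamily
import Summits.QuantumAdvantage.QuantumAdvantage.Theorems.SoloInformedCanonicalBit
import Literature.Computability.Complexity.AdaptiveQueries
import Literature.Computability.Complexity.BinarySearchPP
import Literature.Computability.Complexity.KannanLanguage
import Literature.Computability.Complexity.StackBricks
import Literature.Computability.Complexity.CircuitEval
import HarnessLib

/-!
# Value-determined lifts, part 3: a value-determined lift of one threshold problem decides unique-SAT

Solo programme `solo-QuantumAdvantage-informed`, theorem **N1** (part 3 of 3; parts 1–2:
`SoloInformedValueLiftCore`, `SoloInformedValueLiftFamily`).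

**Setting.** The door of the programme (`SoloInformedCanonicalBit.promiseIsLift_iff_thresholdLift`):
`PromiseBQP ⊆ promiseLift BQP` (Q-EXT) holds iff for every uniform oracle-free family `F` the
threshold promise problem `Thr(F) = ({x | p_F(x) ≥ 7/12}, {x | p_F(x) ≤ 5/12})` is solved by a `BQP`
language. The cheapest imaginable solution is a ROUNDING RULE: membership a function of the value
`p_F(x)` alone. Call a language `L` *value-determined* for `F` if `p_F(x) = p_F(x') → (x ∈ L ↔ x' ∈ L)`;
the proof uses this only LOCALLY (`ValueDeterminedAt F L u d`): between a comparison instance and a probe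
instance (below) sharing the witness length `|u|` and the checked object `d`.

**Theorem N1** (`uniqueSAT_mem_promiseLift_PRel`). For every witness checker `W ∈ P` and the explicit
family `affFamily hW` of part 2: every `L` solving `Thr(affFamily hW)` that is (locally) value-determined
decides unique-`W` (`uniqueSAT W`: one witness vs none) with `|x|` adaptive queries:
`uniqueSAT W ∈ promiseLift (P^L)`; inside a class `C`, `uniqueSAT W ∈ promise-P^C`
(`uniqueSAT_mem_promiseLift_PRelClass`, `…_of_lift_P`). For the circuit-SAT checker (`circuitUSAT`) this
is unique-SAT, whence `NP ⊆ RP` by Valiant–Vazirani (`AffineHash.valiant_vazirani`; the reduction is not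
formalised here). Under Q-EXT the forced `BQP` solution (`exists_BQP_lift_affFamily_of_QEXT`) is NOT a
rounding rule of the value, or `uniqueSAT W ∈ promise-P^BQP` (`QEXT_valueDetermined_dichotomy`).

**Proof** (bisection on the value axis, Arora–Barak 2009 §17.2.1 in shape). Comparison instances
`⟨u, c, 1, ∅, d⟩` have value `V(m) = (3·2^v - m)/2^{v+2}`, `m = val c ≤ 2^{v+1}`, probe instances
`⟨u, c, ∅, 1, d⟩` value `V(val c + #W(d))`. Value-determinedness turns one answer on a comparison
instance into the colour of every probe instance of `(u, d)` of that value (`Good m` / `Bad m`);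
`V(0) = 3/4` is Good, `V(2^{v+1}) = 1/4` is Bad, so `v + 1` midpoint queries
(`SoloInformedValueLiftCore.bisect_adjacent`) find `Good C`, `Bad (C+1)`, and the probe at `C` answers `1`
iff `#W(d) = 0`, `0` iff `#W(d) = 1`. The machine is the tree's adaptive normal form (`AdQuery.adLang`,
`adLang_mem_PRel`): query generator `usatQ ∈ FP`, budget `X`, verdict `usatD ∈ P` reading bit `v + 1`.

References: Arora–Barak 2009, §17.2.1 (binary search with an oracle), §3.4; Valiant–Vazirani 1986;
Ladner–Lynch–Selman 1975, §2.
-/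

namespace Summit.QuantumAdvantage.QuantumAdvantage.Theorems

open _root_.Computability Literature.Computability.Complexity Literature.Computability.Complexity.Classes
  Literature.Computability.Cryptography Literature.Computability.QuantumComplexity Brick Plumb AdQuery

/-! ### Value-determined languages -/

/-- **Value-determined** (a rounding rule): membership in `L` depends on `x` only through the
acceptance probability `p_F(x)`. [folklore] -/
def ValueDetermined (F : QCircuitFamily cliffordT) (L : Language Bool) : Prop :=
  ∀ x x', F.acceptProbOn 0 x = F.acceptProbOn 0 x' → (x ∈ L ↔ x' ∈ L)

/-- The `(7/12, 5/12)` threshold promise problem of a family (the door's test problems,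
`promiseIsLift_iff_thresholdLift`). [folklore] -/
def thresholdProblem (F : QCircuitFamily cliffordT) : PromiseProblem :=
  ⟨{x | 7 / 12 ≤ F.acceptProbOn 0 x}, {x | F.acceptProbOn 0 x ≤ 5 / 12}⟩

/-- **Value-determined AT `(u, d)`** — the only instance of value-determination the reduction uses:
`L` does not distinguish a comparison instance `⟨u, c, 1, ∅, d⟩` from a probe instance `⟨u, c', ∅, 1, d⟩`
(same witness length `|u|`, same checked object `d`) of the same acceptance probability. [folklore] -/
def ValueDeterminedAt (F : QCircuitFamily cliffordT) (L : Language Bool) (u d : List Bool) : Prop :=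
  ∀ c c' : List Bool, F.acceptProbOn 0 (affInst u c [true] [] d) = F.acceptProbOn 0 (affInst u c' [] [true] d) →
    (affInst u c [true] [] d ∈ L ↔ affInst u c' [] [true] d ∈ L)

/-- A value-determined language is value-determined at every `(u, d)`. [folklore] -/
theorem valueDeterminedAt_of_valueDetermined {F : QCircuitFamily cliffordT} {L : Language Bool}
    (h : ValueDetermined F L) (u d : List Bool) : ValueDeterminedAt F L u d :=
  fun _ _ hp => h _ _ hp

/-! ### The reduction: query generator and verdict -/

/-- Round test on `⟨⟨u, d⟩, a⟩`: "`|a| ≥ |u| + 1`" (`(1 u).drop |a| = []`). [folklore] -/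
noncomputable def condQ : List Bool → List Bool := isNilFn ∘ dropFn ∘ pairFn sndP (List.cons true ∘ fstP ∘ fstP)

/-- The midpoint numeral `0^{v-|a|} 1 aʳ` (= `midCode v a`) from `⟨⟨u, d⟩, a⟩`. [folklore] -/
noncomputable def midC : List Bool → List Bool :=
  fun t => (Kannan.zerosFn ∘ dropFn ∘ pairFn sndP (fstP ∘ fstP)) t ++ (List.cons true ∘ List.reverse ∘ sndP) t

/-- The midpoint (comparison) query `⟨u, midCode v a, 1, ∅, d⟩`. [folklore] -/
noncomputable def midQ : List Bool → List Bool :=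
  pairFn (fstP ∘ fstP) (pairFn midC (pairFn (fun _ => [true]) (pairFn (fun _ => []) (sndP ∘ fstP))))

/-- The probe query `⟨u, aʳ, ∅, 1, d⟩`. [folklore] -/
noncomputable def prbQ : List Bool → List Bool :=
  pairFn (fstP ∘ fstP) (pairFn (List.reverse ∘ sndP) (pairFn (fun _ => []) (pairFn (fun _ => [true]) (sndP ∘ fstP))))

/-- **The query generator**: midpoint queries for `|a| ≤ v`, the probe afterwards.
[cite: AroraBarak2009, §17.2.1] -/
noncomputable def usatQ : List Bool → List Bool := iteFn condQ prbQ midQ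

/-- **The verdict**: accept `⟨⟨u, d⟩, bits⟩` iff answer bit `v + 1` (the probe's) is `0`. [folklore] -/
def usatD : Language Bool :=
  {t | bitAtFn (boolPair (true :: fstP (fstP t)) (sndP t)) = [false]}

/-- `usatQ ∈ FP`. [cite: AroraBarak2009, §1.3] -/
theorem usatQ_mem_FP : usatQ ∈ FP := by
  have hU : (fstP ∘ fstP : List Bool → List Bool) ∈ FP := comp_mem_FP fstP_mem_FP fstP_mem_FP
  have hD : (sndP ∘ fstP : List Bool → List Bool) ∈ FP := comp_mem_FP sndP_mem_FP fstP_mem_FP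
  have hc : condQ ∈ FP := comp_mem_FP isNilFn_mem_FP (comp_mem_FP dropFn_mem_FP
    (pairFn_mem_FP sndP_mem_FP (comp_mem_FP (cons_mem_FP true) hU)))
  have hz : (Kannan.zerosFn ∘ dropFn ∘ pairFn sndP (fstP ∘ fstP)) ∈ FP :=
    comp_mem_FP Kannan.zerosFn_mem_FP (comp_mem_FP dropFn_mem_FP (pairFn_mem_FP sndP_mem_FP hU))
  have hr : (List.cons true ∘ List.reverse ∘ sndP) ∈ FP :=
    comp_mem_FP (cons_mem_FP true) (comp_mem_FP BinSearchPP.reverse_mem_FP sndP_mem_FP)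
  have hm : midC ∈ FP := Literature.Computability.Complexity.append_mem_FP hz hr
  have hmid : midQ ∈ FP := pairFn_mem_FP hU (pairFn_mem_FP hm (pairFn_mem_FP (const_mem_FP _)
    (pairFn_mem_FP (const_mem_FP _) hD)))
  have hprb : prbQ ∈ FP := pairFn_mem_FP hU (pairFn_mem_FP (comp_mem_FP BinSearchPP.reverse_mem_FP sndP_mem_FP)
    (pairFn_mem_FP (const_mem_FP _) (pairFn_mem_FP (const_mem_FP _) hD)))
  exact iteFn_mem_FP hc hprb hmid

/-- `usatD ∈ P`. [cite: AroraBarak2009, §1.3] -/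
theorem usatD_mem_P : usatD ∈ P := by
  refine mem_P_of_mem_FP (g := eqPairFn ∘ pairFn (bitAtFn ∘ pairFn (List.cons true ∘ fstP ∘ fstP) sndP) fun _ => [false])
    (comp_mem_FP eqPairFn_mem_FP (pairFn_mem_FP (comp_mem_FP bitAtFn_mem_FP
      (pairFn_mem_FP (comp_mem_FP (cons_mem_FP true) (comp_mem_FP fstP_mem_FP fstP_mem_FP)) sndP_mem_FP))
      (const_mem_FP _))) usatD fun t => ?_
  have e : (eqPairFn ∘ pairFn (bitAtFn ∘ pairFn (List.cons true ∘ fstP ∘ fstP) sndP) fun _ => [false]) t =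
      [decide (bitAtFn (boolPair (true :: fstP (fstP t)) (sndP t)) = [false])] := by
    simp only [Function.comp_apply, pairFn_apply, eqPairFn_boolPair]
  rw [e]
  by_cases h : bitAtFn (boolPair (true :: fstP (fstP t)) (sndP t)) = [false]
  · exact ⟨fun _ => by rw [decide_eq_true h], fun hn => absurd h hn⟩
  · exact ⟨fun hm => absurd hm h, fun _ => by rw [decide_eq_false h]⟩

/-- The round test is `0` while `|a| ≤ v`. [folklore] -/
theorem condQ_of_le (u d a : List Bool) (ha : a.length ≤ u.length) : condQ (boolPair (boolPair u d) a) = [false] := by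
  simp only [condQ, Function.comp_apply, pairFn_apply, sndP_boolPair, fstP_boolPair, dropFn_boolPair, isNilFn]
  congr 1
  rw [decide_eq_false_iff_not]
  intro h
  have := congrArg List.length h
  rw [List.length_drop, List.length_cons, List.length_nil] at this
  omega

/-- The round test is `1` once `|a| ≥ v + 1`. [folklore] -/
theorem condQ_of_gt (u d a : List Bool) (ha : u.length + 1 ≤ a.length) : condQ (boolPair (boolPair u d) a) = [true] := by
  simp only [condQ, Function.comp_apply, pairFn_apply, sndP_boolPair, fstP_boolPair, dropFn_boolPair, isNilFn]
  congr 1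
  rw [decide_eq_true_iff]
  exact List.drop_of_length_le (by rw [List.length_cons]; omega)

/-- **Midpoint rounds**: for `|a| ≤ v` the query is the comparison instance at `midCode v a`.
[cite: AroraBarak2009, §17.2.1] -/
theorem usatQ_mid (u d a : List Bool) (ha : a.length ≤ u.length) :
    usatQ (boolPair (boolPair u d) a) = affInst u (midCode u.length a) [true] [] d := by
  rw [usatQ, iteFn_apply_false (condQ_of_le u d a ha)]
  simp only [midQ, midC, Function.comp_apply, pairFn_apply, fstP_boolPair, sndP_boolPair, dropFn_boolPair,
    Kannan.zerosFn_apply, List.length_drop]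
  rfl

/-- **The probe round**: for `|a| ≥ v + 1` the query is the probe instance at `aʳ`.
[cite: AroraBarak2009, §17.2.1] -/
theorem usatQ_probe (u d a : List Bool) (ha : u.length + 1 ≤ a.length) :
    usatQ (boolPair (boolPair u d) a) = affInst u a.reverse [] [true] d := by
  rw [usatQ, iteFn_apply_true (condQ_of_gt u d a ha)]
  simp only [prbQ, Function.comp_apply, pairFn_apply, fstP_boolPair, sndP_boolPair]
  rfl

/-- Membership in the verdict: answer bit `|u| + 1` is `0`. [folklore] -/
theorem mem_usatD_iff (u d bits : List Bool) :
    boolPair (boolPair u d) bits ∈ usatD ↔ (bits.drop (u.length + 1)).take 1 = [false] := by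
  change bitAtFn (boolPair (true :: fstP (fstP (boolPair (boolPair u d) bits))) (sndP (boolPair (boolPair u d) bits))) =
    [false] ↔ _
  simp only [fstP_boolPair, sndP_boolPair, bitAtFn_boolPair, List.length_cons]

/-- **Reading one answer bit**: bit `i` of the answer string of `n ≥ i + 1` rounds is the oracle's
answer to query `i`. [folklore] -/
theorem adBits_bit {Q : List Bool → List Bool} (A : Language Bool) (x : List Bool) {i n : ℕ} (h : i + 1 ≤ n) :
    ((adBits Q A x n).drop i).take 1 = [A.boolIndicator (Q (boolPair x (adBits Q A x i)))] := by
  have ht := adBits_take (Q := Q) A x h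
  rw [adBits_succ] at ht
  have hsplit := List.take_append_drop (i + 1) (adBits Q A x n)
  rw [ht] at hsplit
  rw [← hsplit, List.append_assoc, List.drop_left' (length_adBits (Q := Q) A x i)]
  rfl

/-! ### The bisection analysis -/

section Analysis

variable {L : Language Bool} {W : Language Bool} {hW : W ∈ P}

/-- The value ladder `V(m) = (3·2^v - m) / 2^{v+2}`. [folklore] -/
noncomputable def vval (v m : ℕ) : ℝ := ((3 * 2 ^ v - m : ℕ) : ℝ) / 2 ^ (v + 2)

/-- `Good m`: every probe instance `⟨u, c', ∅, 1, d⟩` of value `V(m)` lies in `L`. [folklore] -/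
def Good (F : QCircuitFamily cliffordT) (L : Language Bool) (u d : List Bool) (m : ℕ) : Prop :=
  ∀ c', F.acceptProbOn 0 (affInst u c' [] [true] d) = vval u.length m → affInst u c' [] [true] d ∈ L

/-- `Bad m`: every probe instance `⟨u, c', ∅, 1, d⟩` of value `V(m)` lies outside `L`. [folklore] -/
def Bad (F : QCircuitFamily cliffordT) (L : Language Bool) (u d : List Bool) (m : ℕ) : Prop :=
  ∀ c', F.acceptProbOn 0 (affInst u c' [] [true] d) = vval u.length m → affInst u c' [] [true] d ∉ L

/-- `V(0) = 3/4` is Good for a solution of the threshold problem. [folklore] -/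
theorem good_zero {F : QCircuitFamily cliffordT} (hY : (thresholdProblem F).yes ≤ L) (u d : List Bool) :
    Good F L u d 0 := by
  intro c' hz
  apply hY
  show (7 : ℝ) / 12 ≤ F.acceptProbOn 0 _
  rw [hz, vval]
  have h2 : (2 : ℝ) ^ (u.length + 2) = 2 ^ u.length * 4 := by rw [pow_add]; norm_num
  rw [h2, Nat.sub_zero]
  push_cast
  rw [div_le_div_iff₀ (by norm_num) (by positivity)]
  nlinarith [pow_pos (show (0 : ℝ) < 2 by norm_num) u.length]

/-- `V(2^{v+1}) = 1/4` is Bad for a solution of the threshold problem. [folklore] -/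
theorem bad_top {F : QCircuitFamily cliffordT} (hN : (thresholdProblem F).no ≤ Lᶜ) (u d : List Bool) :
    Bad F L u d (2 ^ (u.length + 1)) := by
  intro c' hz
  apply hN
  show F.acceptProbOn 0 _ ≤ 5 / 12
  rw [hz, vval]
  have h2 : (2 : ℝ) ^ (u.length + 2) = 2 ^ u.length * 4 := by rw [pow_add]; norm_num
  have h3 : 3 * 2 ^ u.length - 2 ^ (u.length + 1) = 2 ^ u.length := by rw [pow_succ]; omega
  rw [h2, h3]
  push_cast
  rw [div_le_div_iff₀ (by positivity) (by norm_num)]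
  nlinarith [pow_pos (show (0 : ℝ) < 2 by norm_num) u.length]

/-- **Value-determinedness upgrades one answer to a level**: a comparison instance in `L` makes
its level Good, one outside makes it Bad. [folklore] -/
theorem good_or_bad_of_cmp {u d : List Bool} (hV : ValueDeterminedAt (affFamily hW) L u d) (c : List Bool)
    (hc : bitsToNat c ≤ 2 ^ (u.length + 1)) :
    (affInst u c [true] [] d ∈ L → Good (affFamily hW) L u d (bitsToNat c)) ∧
      (affInst u c [true] [] d ∉ L → Bad (affFamily hW) L u d (bitsToNat c)) := by
  have hp : (affFamily hW).acceptProbOn 0 (affInst u c [true] [] d) = vval u.length (bitsToNat c) :=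
    acceptProbOn_affFamily_cmp hW u c d hc
  exact ⟨fun hm c' hz => (hV c c' (hp.trans hz.symm)).1 hm,
    fun hm c' hz hzL => hm ((hV c c' (hp.trans hz.symm)).2 hzL)⟩

/-- **The bisection finds the Good/Bad boundary.** After `v + 1` midpoint rounds on `⟨u, d⟩` the
reversed answer string `C` satisfies `Good C`, `Bad (C + 1)`, `C + 1 ≤ 2^{v+1}`.
[cite: AroraBarak2009, §17.2.1] -/
theorem bisection_boundary (hY : (thresholdProblem (affFamily hW)).yes ≤ L) (hN : (thresholdProblem (affFamily hW)).no ≤ Lᶜ)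
    (u d : List Bool) (hV : ValueDeterminedAt (affFamily hW) L u d) :
    Good (affFamily hW) L u d (bitsToNat (adBits usatQ L (boolPair u d) (u.length + 1)).reverse) ∧
      Bad (affFamily hW) L u d (bitsToNat (adBits usatQ L (boolPair u d) (u.length + 1)).reverse + 1) ∧
      bitsToNat (adBits usatQ L (boolPair u d) (u.length + 1)).reverse + 1 ≤ 2 ^ (u.length + 1) := by
  have hlen : ∀ k, (adBits usatQ L (boolPair u d) k).length = k := fun k => length_adBits _ _ k
  -- the midpoint query of round `k ≤ v`, its numeral and the bound making its value `V(lo + 2^{v-k})`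
  have hmid : ∀ k ≤ u.length, usatQ (boolPair (boolPair u d) (adBits usatQ L (boolPair u d) k)) =
      affInst u (midCode u.length (adBits usatQ L (boolPair u d) k)) [true] [] d :=
    fun k hk => usatQ_mid u d _ (by rw [hlen]; exact hk)
  have hmidc : ∀ k ≤ u.length, bitsToNat (midCode u.length (adBits usatQ L (boolPair u d) k)) =
      lo u.length (adBits usatQ L (boolPair u d) k) + 2 ^ (u.length - k) := fun k hk => by
    rw [bitsToNat_midCode (by rw [hlen]; exact hk), hlen]
  have hmidle : ∀ k ≤ u.length,
      lo u.length (adBits usatQ L (boolPair u d) k) + 2 ^ (u.length - k) ≤ 2 ^ (u.length + 1) := fun k hk => by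
    have h1 := lo_add_pow_le (v := u.length) (a := adBits usatQ L (boolPair u d) k) (by rw [hlen]; omega)
    rw [hlen] at h1
    exact le_trans (Nat.add_le_add_left (Nat.pow_le_pow_right (by norm_num) (by omega)) _) h1
  refine bisect_adjacent (Good := Good (affFamily hW) L u d) (Bad := Bad (affFamily hW) L u d) (a := adBits usatQ L (boolPair u d))
    (β := fun k => L.boolIndicator (usatQ (boolPair (boolPair u d) (adBits usatQ L (boolPair u d) k))))
    rfl (fun k => adBits_succ _ _ k) (good_zero hY u d) (bad_top hN u d) (fun k hk hb => ?_) (fun k hk hb => ?_)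
  · have hm : affInst u (midCode u.length (adBits usatQ L (boolPair u d) k)) [true] [] d ∈ L := by
      rw [← hmid k hk]; exact (Set.mem_iff_boolIndicator _ _).2 hb
    have := (good_or_bad_of_cmp hV _ (by rw [hmidc k hk]; exact hmidle k hk)).1 hm
    rwa [hmidc k hk] at this
  · have hm : affInst u (midCode u.length (adBits usatQ L (boolPair u d) k)) [true] [] d ∉ L := by
      rw [← hmid k hk]
      intro h
      exact Bool.noConfusion (((Set.mem_iff_boolIndicator _ _).1 h).symm.trans hb)
    have := (good_or_bad_of_cmp hV _ (by rw [hmidc k hk]; exact hmidle k hk)).2 hm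
    rwa [hmidc k hk] at this

/-- **The probe answer decides `#SAT ∈ {0, 1}`**: with `C` the bisection boundary, the probe instance
`⟨u, C, ∅, 1, d⟩` is in `L` if `#SAT(d) = 0` and outside `L` if `#SAT(d) = 1`. [folklore] -/
theorem probe_answer (hY : (thresholdProblem (affFamily hW)).yes ≤ L) (hN : (thresholdProblem (affFamily hW)).no ≤ Lᶜ)
    (u d : List Bool) (hV : ValueDeterminedAt (affFamily hW) L u d) :
    (satCount W u d = 0 → usatQ (boolPair (boolPair u d) (adBits usatQ L (boolPair u d) (u.length + 1))) ∈ L) ∧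
      (satCount W u d = 1 → usatQ (boolPair (boolPair u d) (adBits usatQ L (boolPair u d) (u.length + 1))) ∉ L) := by
  obtain ⟨hG, hB, hle⟩ := bisection_boundary hY hN u d hV
  set a := adBits usatQ L (boolPair u d) (u.length + 1) with ha
  have hlen : a.length = u.length + 1 := length_adBits _ _ _
  have hq : usatQ (boolPair (boolPair u d) a) = affInst u a.reverse [] [true] d := usatQ_probe u d a (by omega)
  have hc : bitsToNat a.reverse ≤ 2 ^ (u.length + 1) := by omega
  have hp := acceptProbOn_affFamily_probe hW u a.reverse d hc
  rw [hq]
  constructor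
  · intro h0
    apply hG
    rw [hp, h0, vval, Nat.cast_zero, sub_zero]
  · intro h1
    apply hB
    rw [hp, h1, vval]
    congr 1
    have h3 : bitsToNat a.reverse + 1 ≤ 3 * 2 ^ u.length := hle.trans (by rw [pow_succ]; omega)
    rw [Nat.cast_sub h3, Nat.cast_sub (by omega : bitsToNat a.reverse ≤ 3 * 2 ^ u.length)]
    push_cast
    ring

/-- **The reduced language is correct on YES instances.** [folklore] -/
theorem uniqueSAT_yes_subset_adLang (hY : (thresholdProblem (affFamily hW)).yes ≤ L)
    (hN : (thresholdProblem (affFamily hW)).no ≤ Lᶜ) (hV : ∀ u d, ValueDeterminedAt (affFamily hW) L u d) :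
    (uniqueSAT W).yes ≤ adLang usatQ Polynomial.X usatD L := by
  rintro x ⟨u, d, rfl, h1⟩
  refine mem_adLang_iff.2 ?_
  rw [Polynomial.eval_X, mem_usatD_iff, adBits_bit L _ (by rw [length_boolPair]; omega),
    (Set.notMem_iff_boolIndicator _ _).1 ((probe_answer hY hN u d (hV u d)).2 h1)]

/-- **The reduced language is correct on NO instances.** [folklore] -/
theorem uniqueSAT_no_subset_adLang_compl (hY : (thresholdProblem (affFamily hW)).yes ≤ L)
    (hN : (thresholdProblem (affFamily hW)).no ≤ Lᶜ) (hV : ∀ u d, ValueDeterminedAt (affFamily hW) L u d) :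
    (uniqueSAT W).no ≤ (adLang usatQ Polynomial.X usatD L)ᶜ := by
  rintro x ⟨u, d, rfl, h0⟩ hx
  have hx' := mem_adLang_iff.1 hx
  rw [Polynomial.eval_X, mem_usatD_iff, adBits_bit L _ (by rw [length_boolPair]; omega),
    (Set.mem_iff_boolIndicator _ _).1 ((probe_answer hY hN u d (hV u d)).1 h0)] at hx'
  exact absurd hx' (by decide)

end Analysis

/-! ### Theorem N1 and its corollaries -/

/-- **Theorem N1 (value-determined lifts are `USAT`-hard).** Every solution `L` of the threshold problem
of `affFamily hW` that is value-determined at every `(u, d)` (between comparison and probe instances of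
the same witness length and checked object) decides unique-`W` in `P^L`:
`uniqueSAT W ∈ promiseLift (P^L)`. [cite: AroraBarak2009, §17.2.1] -/
theorem uniqueSAT_mem_promiseLift_PRel {W : Language Bool} {hW : W ∈ P} {L : Language Bool} (hY : (thresholdProblem (affFamily hW)).yes ≤ L)
    (hN : (thresholdProblem (affFamily hW)).no ≤ Lᶜ) (hV : ∀ u d, ValueDeterminedAt (affFamily hW) L u d) :
    uniqueSAT W ∈ promiseLift (PRel (Oracle.ofLanguage L)) :=
  ⟨adLang usatQ Polynomial.X usatD L, adLang_mem_PRel usatQ_mem_FP usatD_mem_P L,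
    uniqueSAT_yes_subset_adLang hY hN hV, uniqueSAT_no_subset_adLang_compl hY hN hV⟩

/-- N1 for a (globally) value-determined solution. [cite: AroraBarak2009, §17.2.1] -/
theorem uniqueSAT_mem_promiseLift_PRel_of_valueDetermined {W : Language Bool} {hW : W ∈ P} {L : Language Bool}
    (hY : (thresholdProblem (affFamily hW)).yes ≤ L) (hN : (thresholdProblem (affFamily hW)).no ≤ Lᶜ)
    (hV : ValueDetermined (affFamily hW) L) : uniqueSAT W ∈ promiseLift (PRel (Oracle.ofLanguage L)) :=
  uniqueSAT_mem_promiseLift_PRel hY hN (valueDeterminedAt_of_valueDetermined hV)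

/-- **N1, class form.** A value-determined solution inside a class `C` puts `uniqueSAT W` in
`promise-P^C`. [cite: LadnerLynchSelman1975, §2] -/
theorem uniqueSAT_mem_promiseLift_PRelClass {W : Language Bool} {hW : W ∈ P} {C : Set (Language Bool)} {L : Language Bool} (hL : L ∈ C)
    (hY : (thresholdProblem (affFamily hW)).yes ≤ L) (hN : (thresholdProblem (affFamily hW)).no ≤ Lᶜ)
    (hV : ∀ u d, ValueDeterminedAt (affFamily hW) L u d) : uniqueSAT W ∈ promiseLift (PRelClass C) :=
  ⟨adLang usatQ Polynomial.X usatD L, adLang_mem_PRelClass usatQ_mem_FP usatD_mem_P hL,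
    uniqueSAT_yes_subset_adLang hY hN hV, uniqueSAT_no_subset_adLang_compl hY hN hV⟩

/-- **N1, classical form.** A value-determined solution in `P` puts unique-`W` in `PromiseP`
(for the circuit-SAT checker: whence `NP ⊆ RP` by Valiant–Vazirani, `AffineHash.valiant_vazirani` — not
formalised here).
[cite: AroraBarak2009, §17.2.1] -/
theorem uniqueSAT_mem_PromiseP_of_lift_P {W : Language Bool} {hW : W ∈ P} {L : Language Bool} (hL : L ∈ P)
    (hY : (thresholdProblem (affFamily hW)).yes ≤ L) (hN : (thresholdProblem (affFamily hW)).no ≤ Lᶜ)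
    (hV : ∀ u d, ValueDeterminedAt (affFamily hW) L u d) : uniqueSAT W ∈ promiseLift P :=
  ⟨adLang usatQ Polynomial.X usatD L, adLang_mem_P usatQ_mem_FP usatD_mem_P hL,
    uniqueSAT_yes_subset_adLang hY hN hV, uniqueSAT_no_subset_adLang_compl hY hN hV⟩

/-- **Q-EXT forces a `BQP` solution of `Thr(affFamily hW)`** (the door, specialised to this one family).
[cite: BernsteinVazirani1997, Thm. 8.3] -/
theorem exists_BQP_lift_affFamily_of_QEXT (hExt : PromiseBQP ⊆ promiseLift BQP) {W : Language Bool}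
    (hW : W ∈ P) :
    ∃ L ∈ BQP, (thresholdProblem (affFamily hW)).yes ≤ L ∧ (thresholdProblem (affFamily hW)).no ≤ Lᶜ :=
  hExt (symmThresholdPromise_mem_PromiseBQP (affFamily_isOracleFree hW) (affFamily_isUniform hW))

/-- **The dichotomy under Q-EXT.** If `PromiseBQP ⊆ promiseLift BQP` then, for every checker `W ∈ P`,
the threshold problem of `affFamily hW` has a `BQP` solution `L`, and EITHER `L` separates a comparison
instance from a probe instance with the same `(u, d)` and the same acceptance probability (it is not a
rounding rule of the value, not even locally) OR unique-`W` is in `promise-P^BQP`.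
[cite: BernsteinVazirani1997, Thm. 8.3] [cite: AroraBarak2009, §17.2.1] -/
theorem QEXT_valueDetermined_dichotomy (hExt : PromiseBQP ⊆ promiseLift BQP) {W : Language Bool}
    (hW : W ∈ P) :
    ∃ L ∈ BQP, (thresholdProblem (affFamily hW)).yes ≤ L ∧ (thresholdProblem (affFamily hW)).no ≤ Lᶜ ∧
      ((∃ u d, ¬ ValueDeterminedAt (affFamily hW) L u d) ∨ uniqueSAT W ∈ promiseLift (PRelClass BQP)) := by
  obtain ⟨L, hL, hY, hN⟩ := exists_BQP_lift_affFamily_of_QEXT hExt hW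
  refine ⟨L, hL, hY, hN, ?_⟩
  by_cases hV : ∀ u d, ValueDeterminedAt (affFamily hW) L u d
  · exact Or.inr (uniqueSAT_mem_promiseLift_PRelClass hL hY hN hV)
  · push Not at hV
    exact Or.inl hV

/-! ### The circuit instance: unique-SAT -/

/-- **Unique circuit-SAT**: the instance `W = CircEval.EvalLang` of `uniqueSAT` — instances `⟨u, d⟩` with
`d` a circuit description for the tree's evaluator, YES = exactly one accepted input of length `|u|`,
NO = none (the target of the Valiant–Vazirani isolation). [cite: AroraBarak2009, Thm. 6.18] -/
def circuitUSAT : PromiseProblem := uniqueSAT CircEval.EvalLang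

/-- **The dichotomy under Q-EXT, circuit form**: the `BQP` solution of the circuit family's threshold
problem separates a comparison instance from a probe instance of the same circuit with the same value, or
unique circuit-SAT is in `promise-P^BQP`. [cite: BernsteinVazirani1997, Thm. 8.3]
[cite: AroraBarak2009, §17.2.1] -/
theorem QEXT_valueDetermined_dichotomy_circuit (hExt : PromiseBQP ⊆ promiseLift BQP) :
    ∃ L ∈ BQP, (thresholdProblem (affFamily CircEval.EvalLang_mem_P)).yes ≤ L ∧
      (thresholdProblem (affFamily CircEval.EvalLang_mem_P)).no ≤ Lᶜ ∧
      ((∃ u d, ¬ ValueDeterminedAt (affFamily CircEval.EvalLang_mem_P) L u d) ∨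
        circuitUSAT ∈ promiseLift (PRelClass BQP)) :=
  QEXT_valueDetermined_dichotomy hExt CircEval.EvalLang_mem_P

end Summit.QuantumAdvantage.QuantumAdvantage.Theorems
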